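import Literature.MathematicalPhysics.QuantumFieldTheory.Balaban1983to89.Beta.PolarizationSign
import Literature.Probability.LatticeModels.BesselSaddleComplex

/-!
# `Balaban1983to89.Beta.MomentSymbol` — the one-loop coefficient `β⁰_{k+1} = Σ_x Π(x) x_μ x_ν` (1.22) is a
# MOMENTUM-SPACE quantity: (minus) the polarised second DIRECTIONAL derivative at `t = 0` of the kernel's symbol
# restricted to lines; hence a RATE for β needs only a rate for three numbers read off the symbol at zero
# momentum — no position-space decay constant enters (β sub-cell, asymptotic lane asym1, R-asym1-2)

HONEST FRAMING (cell rule, verbatim, page 1 of everything the β sub-cell writes): discharging `BetaPertH` makes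
Bałaban's UV stability UNCONDITIONAL — a real constructive-QFT result; it is NOT the continuum limit and NOT the Clay
problem.  THIS MODULE DISCHARGES NOTHING of the series: it is `[folklore]` real analysis (differentiation of a
lattice Fourier series under the sum) about an ARBITRARY kernel component `f : ℤ^d → ℝ` with a summable second
moment, and its only contact with [Balaban1987RG1] is the MEANING of `B12Beta.secondMoment` ((1.22) p. 264).
Value = kernel-checked bookkeeping for the asymptotic lane's recommendation R-asym1-2 (HOME/BETA/ASYM-beta.md §3.2),
NOT summit progress.

CITATION HEADER (lean-in-tree rule 2026-08-18).  T. Bałaban, *Renormalization group approach to lattice gauge field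
theories. I.*, Commun. Math. Phys. **109**, 249–301 (1987) [Balaban1987RG1] (cell paper B12; PDF held:
`paper:balaban1987-cmp109-rg-i-small-field`): p. 264 (1.22) `β_{j+1}(g_j) = Σ_x Π_{j+1,μν}(g_j, x) x_μ x_ν`, typed
`B12Beta.secondMoment P μ ν = Σ' x, P μ ν x · x_μ · x_ν`; p. 293 (5.10) the exponential decay of the kernel (typed
`B12Sec2to5.Decay510`), which gives every polynomial moment (`PolarizationSign.momentSummable_of_decay510`) and hence the
hypothesis `Summable (|f x| · size x ^ 2)` used below.  Nothing else of the paper is used or asserted.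

VERSIONS: v1 p184097 (§1–§4); v1.1 (§5, append-only + one import `Literature.Probability.LatticeModels.BesselSaddleComplex`
for the tree's `‖cos w‖ ≤ e^{|Im w|}`; asym1 gen 2 `b2b-balaban-beta-asym1-g2`); v1.2 (§6 THREE-LINES UPGRADE, append-only, same seat).

WHAT THIS MODULE PROVES ([folklore]; Mathlib `hasDerivAt_tsum`).  For `f : (Fin d → ℤ) → ℝ` with
`Summable fun x => |f x| * size x ^ 2` and an integer direction `v`, the DIRECTIONAL SYMBOL
`dirSymbol f v t = Σ' x, f x · cos (t · ⟨v, x⟩)` (the real part of the lattice Fourier series `f̂(t v)`):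
* `hasDerivAt_dirSymbol`, `hasDerivAt_dirSymbolD1`: it is twice differentiable on `ℝ`, with
  `dirSymbolD2 f v t = −Σ' x, f x ⟨v,x⟩² cos (t⟨v,x⟩)` and `dirSymbolD2_zero : dirSymbolD2 f v 0 = −Σ' x, f x ⟨v,x⟩²`;
* `secondMoment_eq_polarization`: for a kernel `P` with `MomentSummable P 2`,
  `secondMoment P μ ν = −½ (D²_{e_μ+e_ν} − D²_{e_μ} − D²_{e_ν})`, `D²_v := dirSymbolD2 (P μ ν) v 0` — the one-loop
  coefficient is the polarised CURVATURE AT ZERO MOMENTUM of the vacuum-polarisation symbol;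
* `abs_secondMoment_sub_le`: consequently `|secondMoment P μ ν − secondMoment P′ μ ν| ≤ (3/2)·ε` as soon as the
  three zero-momentum curvatures of `P μ ν` and `P′ μ ν` agree to within `ε` — the form in which a scale-by-scale
  comparison of SYMBOLS (King 1986 §4-type momentum-space estimates, `King1986/EffectiveLaplacianRate`) delivers the
  Cauchy rate `RateCertificate.CauchyRate S.β0 c θ` WITHOUT any position-space decay constant (ASYM-beta.md §3.2: the
  `e^{−δ|x|}` route inflates the constant by `Σ_x |x|₁² e^{−δ|x|₁}`, e.g. `352` at `δ = 1`, `2.1·10⁴` at `δ = 0.5`).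

* (v1.1, §5) `dirSymbolC f v z = Σ' x, f x · cos (z⟨v,x⟩)` (complex `z`): under an EXPONENTIAL MOMENT
  `ExpMoment f v R : Summable (|f x| · e^{R|⟨v,x⟩|})` it is holomorphic on the disc `‖z‖ < R` and continuous on its
  closure (`diffContOnCl_dirSymbolC`, Mathlib `Complex.differentiableOn_tsum_of_summable_norm`), agrees with `dirSymbol`
  on the real axis and has `iteratedDeriv 2 (dirSymbolC f v) 0 = dirSymbolD2 f v 0` (`iteratedDeriv_two_dirSymbolC_zero`);
  hence CAUCHY'S ESTIMATE `abs_dirSymbolD2_zero_le_of_sphere`: `‖dirSymbolC f v z‖ ≤ ε` on `‖z‖ = R` ⇒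
  `|dirSymbolD2 f v 0| ≤ 2ε/R²`; `expMoment_of_decay510`: (5.10) with rate `δ₁` gives the exponential moment for every
  `R` with `R·max|v_i| < δ₁`.  Consumer: `RateCertificate` §8 (`StripStepRate`, `thm2Printed_of_stripMargin`).

* (v1.2, §6) THE THREE-LINES UPGRADE: under `ExpMoment f v R` the complexified symbol is holomorphic on the open STRIP
  `|Im z| < R`, continuous and bounded by `Σ' |f x| e^{R|⟨v,x⟩|}` on the closed strip (`norm_dirSymbolC_le_of_im`; from
  (5.10): `norm_dirSymbolC_le_of_decay510`, constant `C·Σ_x e^{−(δ₁−RK)|x|₁}`); Hadamard's three-lines theorem between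
  the REAL AXIS and the strip edge (`norm_le_interp_of_real_of_strip`, Mathlib
  `Complex.HadamardThreeLines.norm_le_interp_of_mem_verticalClosedStrip₀₁'` transported by `w ↦ ±iR·w`): a bound `ε` on
  the real axis and `M` on the strip give `ε^{1−|Im z|/R} M^{|Im z|/R}`, hence `ε^{1−r/R} M^{r/R}` on the circle
  `‖z‖ = r ≤ R` (`norm_le_interp_of_sphere`, `norm_dirSymbolC_sub_le_of_real`); with `ε = cθ^k`:
  `(cθ^k)^α = c^α (θ^α)^k` (`rpow_rate`).  So a REAL-momentum rate for the symbols + the printed UNIFORM decay already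
  feed §5's Cauchy estimate — consumer `RateCertificate` §9 (`RealStepRate`, `thm2Printed_of_realMargin`).

WHAT THIS MODULE IS NOT.  No statement about Bałaban's kernels, no rate, no value; it does not touch `B12Beta`,
`PolarizationSign`, `RateCertificate` (used BY NAME or not at all).  One writer: asym1 (`b2b-balaban-beta-asym1`).
-/

namespace Literature.MathematicalPhysics.QuantumFieldTheory.Balaban1983to89.Beta.MomentSymbol

open Literature.MathematicalPhysics.QuantumFieldTheory.Balaban1983to89
open Literature.MathematicalPhysics.QuantumFieldTheory.Balaban1983to89.Beta.PolarizationSign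
  (size one_le_size size_pos abs_apply_le_size MomentSummable)
open Finset
open scoped BigOperators Topology

noncomputable section

variable {d : ℕ}

/-! ## 1. The integer pairing and its size bound -/

/-- The pairing `⟨v, x⟩ = Σ_i v_i x_i` of an integer direction with a lattice point, as a real number. [folklore] -/
def ipair (v x : Fin d → ℤ) : ℝ := ∑ i, (v i : ℝ) * (x i : ℝ)

/-- The `ℓ¹` size of a direction: `Σ_i |v_i|`. [folklore] -/
def dirNorm (v : Fin d → ℤ) : ℝ := ∑ i, |(v i : ℝ)|

/-- `0 ≤ ‖v‖₁`. [folklore] -/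
theorem dirNorm_nonneg (v : Fin d → ℤ) : 0 ≤ dirNorm v := Finset.sum_nonneg fun _ _ => abs_nonneg _

/-- `|⟨v,x⟩| ≤ ‖v‖₁ · size x`. [folklore] -/
theorem abs_ipair_le (v x : Fin d → ℤ) : |ipair v x| ≤ dirNorm v * size x := by
  unfold ipair dirNorm
  calc |∑ i, (v i : ℝ) * (x i : ℝ)| ≤ ∑ i, |(v i : ℝ) * (x i : ℝ)| := Finset.abs_sum_le_sum_abs _ _
    _ = ∑ i, |(v i : ℝ)| * |(x i : ℝ)| := by simp_rw [abs_mul]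
    _ ≤ ∑ i, |(v i : ℝ)| * size x :=
        Finset.sum_le_sum fun i _ => mul_le_mul_of_nonneg_left (abs_apply_le_size x i) (abs_nonneg _)
    _ = (∑ i, |(v i : ℝ)|) * size x := by rw [Finset.sum_mul]

/-- `⟨v,x⟩² ≤ ‖v‖₁² · size x ²`. [folklore] -/
theorem ipair_sq_le (v x : Fin d → ℤ) : ipair v x ^ 2 ≤ dirNorm v ^ 2 * size x ^ 2 := by
  rw [← mul_pow, ← sq_abs (ipair v x)]
  exact pow_le_pow_left₀ (abs_nonneg _) (abs_ipair_le v x) 2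

/-- Linearity of the pairing in the direction. [folklore] -/
theorem ipair_add (v w x : Fin d → ℤ) : ipair (v + w) x = ipair v x + ipair w x := by
  simp [ipair, add_mul, Finset.sum_add_distrib]

/-- The pairing with a coordinate direction is the coordinate. [folklore] -/
theorem ipair_single (μ : Fin d) (x : Fin d → ℤ) : ipair (Pi.single μ 1) x = (x μ : ℝ) := by
  classical
  unfold ipair
  rw [Finset.sum_eq_single μ]
  · simp
  · intro i _ hi; simp [hi]
  · intro h; exact absurd (Finset.mem_univ μ) h

/-! ## 2. The directional symbol and its first two derivatives (differentiation under the lattice sum) -/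

/-- The DIRECTIONAL SYMBOL of a kernel component along an integer direction: `t ↦ Σ' x, f x · cos (t⟨v,x⟩)`, the real
part of the lattice Fourier series of `f` at momentum `t·v`. [folklore] -/
def dirSymbol (f : (Fin d → ℤ) → ℝ) (v : Fin d → ℤ) (t : ℝ) : ℝ :=
  ∑' x, f x * Real.cos (t * ipair v x)

/-- Its first derivative (as a series): `−Σ' x, f x ⟨v,x⟩ sin (t⟨v,x⟩)`. [folklore] -/
def dirSymbolD1 (f : (Fin d → ℤ) → ℝ) (v : Fin d → ℤ) (t : ℝ) : ℝ :=
  ∑' x, -(f x * ipair v x * Real.sin (t * ipair v x))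

/-- Its second derivative (as a series): `−Σ' x, f x ⟨v,x⟩² cos (t⟨v,x⟩)`. [folklore] -/
def dirSymbolD2 (f : (Fin d → ℤ) → ℝ) (v : Fin d → ℤ) (t : ℝ) : ℝ :=
  ∑' x, -(f x * ipair v x ^ 2 * Real.cos (t * ipair v x))

section Deriv

variable {f : (Fin d → ℤ) → ℝ} (hf : Summable fun x => |f x| * size x ^ 2) (v : Fin d → ℤ)
include hf

/-- A summable second moment gives a summable kernel component. [folklore] -/
theorem summable_abs : Summable fun x => |f x| := by
  refine Summable.of_nonneg_of_le (fun x => abs_nonneg _) (fun x => ?_) hf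
  have h1 : (1 : ℝ) ≤ size x ^ 2 := one_le_pow₀ (one_le_size x)
  nlinarith [abs_nonneg (f x)]

/-- … and a summable first moment along any direction. [folklore] -/
theorem summable_abs_mul_ipair : Summable fun x => |f x| * |ipair v x| := by
  refine Summable.of_nonneg_of_le (fun x => mul_nonneg (abs_nonneg _) (abs_nonneg _)) (fun x => ?_)
    (hf.mul_left (dirNorm v))
  have h1 := abs_ipair_le v x
  have h2 : size x ≤ size x ^ 2 := by nlinarith [one_le_size x]
  calc |f x| * |ipair v x| ≤ |f x| * (dirNorm v * size x) := mul_le_mul_of_nonneg_left h1 (abs_nonneg _)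
    _ ≤ |f x| * (dirNorm v * size x ^ 2) :=
        mul_le_mul_of_nonneg_left (mul_le_mul_of_nonneg_left h2 (dirNorm_nonneg v)) (abs_nonneg _)
    _ = dirNorm v * (|f x| * size x ^ 2) := by ring

/-- … and a summable second moment along any direction. [folklore] -/
theorem summable_abs_mul_ipair_sq : Summable fun x => |f x| * ipair v x ^ 2 := by
  refine Summable.of_nonneg_of_le (fun x => mul_nonneg (abs_nonneg _) (sq_nonneg _)) (fun x => ?_)
    (hf.mul_left (dirNorm v ^ 2))
  calc |f x| * ipair v x ^ 2 ≤ |f x| * (dirNorm v ^ 2 * size x ^ 2) :=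
        mul_le_mul_of_nonneg_left (ipair_sq_le v x) (abs_nonneg _)
    _ = dirNorm v ^ 2 * (|f x| * size x ^ 2) := by ring

/-- The terms of `dirSymbol` are summable at every `t`. [folklore] -/
theorem summable_dirSymbol_terms (t : ℝ) : Summable fun x => f x * Real.cos (t * ipair v x) := by
  refine Summable.of_norm_bounded (summable_abs hf) (fun x => ?_)
  rw [Real.norm_eq_abs, abs_mul]
  exact mul_le_of_le_one_right (abs_nonneg _) (Real.abs_cos_le_one _)

/-- **First derivative under the lattice sum.** [folklore] -/
theorem hasDerivAt_dirSymbol (t : ℝ) : HasDerivAt (dirSymbol f v) (dirSymbolD1 f v t) t := by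
  unfold dirSymbol dirSymbolD1
  refine hasDerivAt_tsum (u := fun x => |f x| * |ipair v x|) (summable_abs_mul_ipair hf v)
    (g := fun x s => f x * Real.cos (s * ipair v x))
    (g' := fun x s => -(f x * ipair v x * Real.sin (s * ipair v x))) (fun x s => ?_) (fun x s => ?_)
    (y₀ := 0) (by simpa using summable_abs hf |>.of_abs) t
  · -- derivative of one term
    have h1 : HasDerivAt (fun s : ℝ => s * ipair v x) (ipair v x) s := by
      simpa using (hasDerivAt_id s).mul_const (ipair v x)
    exact (h1.cos.const_mul (f x)).congr_deriv (by ring)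
  · rw [norm_neg, Real.norm_eq_abs, abs_mul, abs_mul]
    exact mul_le_of_le_one_right (mul_nonneg (abs_nonneg _) (abs_nonneg _)) (Real.abs_sin_le_one _)

/-- **Second derivative under the lattice sum.** [folklore] -/
theorem hasDerivAt_dirSymbolD1 (t : ℝ) : HasDerivAt (dirSymbolD1 f v) (dirSymbolD2 f v t) t := by
  unfold dirSymbolD1 dirSymbolD2
  refine hasDerivAt_tsum (u := fun x => |f x| * ipair v x ^ 2) (summable_abs_mul_ipair_sq hf v)
    (g := fun x s => -(f x * ipair v x * Real.sin (s * ipair v x)))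
    (g' := fun x s => -(f x * ipair v x ^ 2 * Real.cos (s * ipair v x))) (fun x s => ?_) (fun x s => ?_)
    (y₀ := 0) (by simp [summable_zero]) t
  · have h1 : HasDerivAt (fun s : ℝ => s * ipair v x) (ipair v x) s := by
      simpa using (hasDerivAt_id s).mul_const (ipair v x)
    exact ((h1.sin.const_mul (f x * ipair v x)).neg).congr_deriv (by ring)
  · rw [norm_neg, Real.norm_eq_abs, abs_mul, abs_mul, abs_sq]
    exact mul_le_of_le_one_right (mul_nonneg (abs_nonneg _) (sq_nonneg _)) (Real.abs_cos_le_one _)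

/-- The symbol is differentiable, with derivative `dirSymbolD1`. [folklore] -/
theorem deriv_dirSymbol (t : ℝ) : deriv (dirSymbol f v) t = dirSymbolD1 f v t :=
  (hasDerivAt_dirSymbol hf v t).deriv

/-- … and twice differentiable, with second derivative `dirSymbolD2`. [folklore] -/
theorem deriv_deriv_dirSymbol (t : ℝ) : deriv (deriv (dirSymbol f v)) t = dirSymbolD2 f v t := by
  have h : deriv (dirSymbol f v) = dirSymbolD1 f v := funext fun s => deriv_dirSymbol hf v s
  rw [h]
  exact (hasDerivAt_dirSymbolD1 hf v t).deriv

omit hf in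
/-- **The curvature at zero momentum is (minus) the directional second moment**:
`dirSymbolD2 f v 0 = −Σ' x, f x ⟨v,x⟩²`. [folklore] -/
theorem dirSymbolD2_zero : dirSymbolD2 f v 0 = -∑' x, f x * ipair v x ^ 2 := by
  unfold dirSymbolD2
  rw [← tsum_neg]
  exact tsum_congr fun x => by simp

omit hf in
/-- The symbol at zero momentum is the zeroth moment `Σ' x, f x`. [folklore] -/
theorem dirSymbol_zero : dirSymbol f v 0 = ∑' x, f x := by
  unfold dirSymbol
  exact tsum_congr fun x => by simp

end Deriv

/-! ## 3. The one-loop coefficient as a polarised zero-momentum curvature -/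

section Polarization

variable {P : B12Beta.Kernel d} (hP : MomentSummable P 2) (μ ν : Fin d)
include hP

/-- The scalar hypothesis of §2 for every component of a kernel with `MomentSummable P 2`. [folklore] -/
theorem component_summable : Summable fun x => |P μ ν x| * size x ^ 2 := hP μ ν

/-- The directional second moment along `e_μ + e_ν` splits: `Σ f (x_μ + x_ν)² = Σ f x_μ² + 2 Σ f x_μ x_ν + Σ f x_ν²`.
[folklore] -/
theorem tsum_ipair_add_sq :
    ∑' x, P μ ν x * ipair (Pi.single μ 1 + Pi.single ν 1) x ^ 2 =
      (∑' x, P μ ν x * ipair (Pi.single μ 1) x ^ 2) + 2 * B12Beta.secondMoment P μ ν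
        + ∑' x, P μ ν x * ipair (Pi.single ν 1) x ^ 2 := by
  have hμ : Summable fun x => P μ ν x * ipair (Pi.single μ 1) x ^ 2 :=
    (summable_abs_mul_ipair_sq (hP μ ν) (Pi.single μ 1)).of_norm_bounded
      (fun x => by rw [Real.norm_eq_abs, abs_mul, abs_sq])
  have hν : Summable fun x => P μ ν x * ipair (Pi.single ν 1) x ^ 2 :=
    (summable_abs_mul_ipair_sq (hP μ ν) (Pi.single ν 1)).of_norm_bounded
      (fun x => by rw [Real.norm_eq_abs, abs_mul, abs_sq])
  have hμν : Summable fun x => P μ ν x * (x μ : ℝ) * (x ν : ℝ) := by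
    refine Summable.of_norm_bounded ((hP μ ν)) (fun x => ?_)
    rw [Real.norm_eq_abs, abs_mul, abs_mul, mul_assoc]
    refine mul_le_mul_of_nonneg_left ?_ (abs_nonneg _)
    rw [sq]
    exact mul_le_mul (abs_apply_le_size x μ) (abs_apply_le_size x ν) (abs_nonneg _) (size_pos x).le
  have e : ∀ x, P μ ν x * ipair (Pi.single μ 1 + Pi.single ν 1) x ^ 2 =
      P μ ν x * ipair (Pi.single μ 1) x ^ 2 + 2 * (P μ ν x * (x μ : ℝ) * (x ν : ℝ))
        + P μ ν x * ipair (Pi.single ν 1) x ^ 2 := by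
    intro x
    rw [ipair_add, ipair_single, ipair_single]
    ring
  have hsm : B12Beta.secondMoment P μ ν = ∑' x, P μ ν x * (x μ : ℝ) * (x ν : ℝ) := rfl
  rw [hsm, tsum_congr e, Summable.tsum_add (hμ.add (hμν.mul_left 2)) hν,
    Summable.tsum_add hμ (hμν.mul_left 2), tsum_mul_left]

/-- **THE ONE-LOOP COEFFICIENT IS A ZERO-MOMENTUM CURVATURE** (polarisation identity):
`secondMoment P μ ν = −½ · (D²_{e_μ+e_ν} − D²_{e_μ} − D²_{e_ν})` with `D²_v = dirSymbolD2 (P μ ν) v 0` the second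
derivative at `t = 0` of the directional symbol `t ↦ Σ' x, P μ ν x cos (t⟨v,x⟩)`.  With `P = Π⁰_{k+1}` this is
(1.22): `β⁰_{k+1}` read off the vacuum-polarisation SYMBOL at zero momentum. [cite: Balaban1987RG1, (1.22) p.264] -/
theorem secondMoment_eq_polarization :
    B12Beta.secondMoment P μ ν =
      -(1 / 2) * (dirSymbolD2 (P μ ν) (Pi.single μ 1 + Pi.single ν 1) 0
        - dirSymbolD2 (P μ ν) (Pi.single μ 1) 0 - dirSymbolD2 (P μ ν) (Pi.single ν 1) 0) := by
  rw [dirSymbolD2_zero (Pi.single μ 1 + Pi.single ν 1), dirSymbolD2_zero (Pi.single μ 1),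
    dirSymbolD2_zero (Pi.single ν 1), tsum_ipair_add_sq hP μ ν]
  ring

end Polarization

/-! ## 4. The rate transfer: symbol curvatures within `ε` ⇒ coefficients within `3ε/2` -/

/-- **RATE TRANSFER (R-asym1-2).**  If two kernels with summable second moments have directional symbols whose
zero-momentum curvatures along `e_μ`, `e_ν`, `e_μ + e_ν` agree to within `ε`, their one-loop coefficients (1.22) agree
to within `(3/2)·ε`.  Applied to `P = Π⁰_{k+2}`, `P′ = Π⁰_{k+1}` with `ε = c·θ^k` this is the Cauchy rate
`RateCertificate.CauchyRate S.β0 ((3/2)·c) θ` — from a momentum-space comparison alone, no position-space decay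
constant. [cite: Balaban1987RG1, (1.22) p.264] -/
theorem abs_secondMoment_sub_le {P P' : B12Beta.Kernel d} (hP : MomentSummable P 2) (hP' : MomentSummable P' 2)
    (μ ν : Fin d) {ε : ℝ}
    (h : ∀ v ∈ ({Pi.single μ 1, Pi.single ν 1, Pi.single μ 1 + Pi.single ν 1} : Set (Fin d → ℤ)),
      |dirSymbolD2 (P μ ν) v 0 - dirSymbolD2 (P' μ ν) v 0| ≤ ε) :
    |B12Beta.secondMoment P μ ν - B12Beta.secondMoment P' μ ν| ≤ 3 / 2 * ε := by
  have h1 := h (Pi.single μ 1) (by simp)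
  have h2 := h (Pi.single ν 1) (by simp)
  have h3 := h (Pi.single μ 1 + Pi.single ν 1) (by simp)
  rw [secondMoment_eq_polarization hP, secondMoment_eq_polarization hP']
  set a := dirSymbolD2 (P μ ν) (Pi.single μ 1 + Pi.single ν 1) 0
  set b := dirSymbolD2 (P μ ν) (Pi.single μ 1) 0
  set c := dirSymbolD2 (P μ ν) (Pi.single ν 1) 0
  set a' := dirSymbolD2 (P' μ ν) (Pi.single μ 1 + Pi.single ν 1) 0
  set b' := dirSymbolD2 (P' μ ν) (Pi.single μ 1) 0
  set c' := dirSymbolD2 (P' μ ν) (Pi.single ν 1) 0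
  have e : -(1 / 2) * (a - b - c) - -(1 / 2) * (a' - b' - c') = -(1 / 2) * ((a - a') - (b - b') - (c - c')) := by
    ring
  rw [e, abs_mul, abs_neg, abs_of_pos (by norm_num : (0 : ℝ) < 1 / 2)]
  have := abs_sub (a - a' - (b - b')) (c - c')
  have := abs_sub (a - a') (b - b')
  nlinarith [abs_nonneg (a - a'), abs_nonneg (b - b'), abs_nonneg (c - c')]

/-- **… and along a sequence of kernels**: a geometric rate `c·θ^k` for the three zero-momentum curvatures of
`P (k+1)` versus `P k` is a Cauchy rate with constant `(3/2)·c` for the one-loop coefficients. [cite: Balaban1987RG1, (1.22) p.264] -/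
theorem cauchyRate_secondMoment {P : ℕ → B12Beta.Kernel d} (hP : ∀ k, MomentSummable (P k) 2) (μ ν : Fin d)
    {c θ : ℝ}
    (h : ∀ k, ∀ v ∈ ({Pi.single μ 1, Pi.single ν 1, Pi.single μ 1 + Pi.single ν 1} : Set (Fin d → ℤ)),
      |dirSymbolD2 (P (k + 1) μ ν) v 0 - dirSymbolD2 (P k μ ν) v 0| ≤ c * θ ^ k) :
    ∀ k, |B12Beta.secondMoment (P (k + 1)) μ ν - B12Beta.secondMoment (P k) μ ν| ≤ 3 / 2 * c * θ ^ k := by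
  intro k
  have := abs_secondMoment_sub_le (hP (k + 1)) (hP k) μ ν (h k)
  linarith

/-- The hypothesis `MomentSummable P 2` from the printed decay (5.10), for the record (= `PolarizationSign`'s lemma at
`n = 2`). [cite: Balaban1987RG1, (5.10) p.293] -/
theorem momentSummable_two_of_decay510 {P : B12Beta.Kernel d} {C δ₁ : ℝ} (hδ : 0 < δ₁)
    (hdec : ∀ μ ν, B12Sec2to5.Decay510 (P μ ν) C δ₁) : MomentSummable P 2 :=
  PolarizationSign.momentSummable_of_decay510 hδ hdec 2

/-! ## 5. (v1.1) The COMPLEXIFIED directional symbol and CAUCHY'S ESTIMATE — the momentum route (S2) of R-asym1-2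
made precise: a bound `ε` for `z ↦ Σ' x, f x cos (z⟨v,x⟩)` on the circle `‖z‖ = R` gives `|dirSymbolD2 f v 0| ≤ 2ε/R²`
(Mathlib `Complex.norm_iteratedDeriv_le_of_forall_mem_sphere_norm_le`), hence (`RateCertificate` §8) a symbol step rate
with constant `2c/R²` and a Cauchy rate `3c/R²` for the one-loop coefficients from CIRCLE/STRIP sup-rates of the
symbols — the shape in which momentum-space proofs (King 1986 §4-type alias-sum estimates, continued to complex momenta
`|Im p| ≤ R`, `R <` the (5.10) decay rate) deliver their constants, with NO factor `Σ_x |x|²e^{−δ|x|}`.  Everything here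
is [folklore] complex analysis about an ARBITRARY `f` with an exponential moment; nothing about Bałaban's kernels. -/

/-- The COMPLEXIFIED directional symbol `z ↦ Σ' x, f x · cos (z⟨v,x⟩)`. [folklore] -/
def dirSymbolC (f : (Fin d → ℤ) → ℝ) (v : Fin d → ℤ) (z : ℂ) : ℂ :=
  ∑' x, (f x : ℂ) * Complex.cos (z * (ipair v x : ℂ))

/-- EXPONENTIAL MOMENT of radius `R` along `v`: `Σ_x |f x| e^{R|⟨v,x⟩|} < ∞`. [folklore] -/
def ExpMoment (f : (Fin d → ℤ) → ℝ) (v : Fin d → ℤ) (R : ℝ) : Prop :=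
  Summable fun x => |f x| * Real.exp (R * |ipair v x|)

/-- Term bound on the closed disc `‖z‖ ≤ R`: `‖f x · cos (z⟨v,x⟩)‖ ≤ |f x| e^{R|⟨v,x⟩|}` (via the tree's
`BesselInterp.norm_cos_le_exp_abs_im : ‖cos w‖ ≤ e^{|Im w|}`, reused by name — gate dedup rule). [folklore] -/
theorem norm_term_le {f : (Fin d → ℤ) → ℝ} {v : Fin d → ℤ} {R : ℝ} {z : ℂ} (hz : ‖z‖ ≤ R)
    (x : Fin d → ℤ) :
    ‖(f x : ℂ) * Complex.cos (z * (ipair v x : ℂ))‖ ≤ |f x| * Real.exp (R * |ipair v x|) := by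
  rw [norm_mul, Complex.norm_real, Real.norm_eq_abs]
  refine mul_le_mul_of_nonneg_left ?_ (abs_nonneg _)
  refine (Literature.Probability.LatticeModels.BesselInterp.norm_cos_le_exp_abs_im _).trans
    (Real.exp_le_exp.mpr ((Complex.abs_im_le_norm _).trans ?_))
  rw [norm_mul, Complex.norm_real, Real.norm_eq_abs]
  exact mul_le_mul_of_nonneg_right hz (abs_nonneg _)

section Strip

variable {f : (Fin d → ℤ) → ℝ} {v : Fin d → ℤ} {R : ℝ}

/-- Each term is entire. [folklore] -/
theorem differentiable_term (f : (Fin d → ℤ) → ℝ) (v : Fin d → ℤ) (x : Fin d → ℤ) :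
    Differentiable ℂ fun z : ℂ => (f x : ℂ) * Complex.cos (z * (ipair v x : ℂ)) :=
  ((Complex.differentiable_cos.comp (differentiable_id.mul_const _)).const_mul _)

/-- Under an exponential moment of radius `R` the complexified symbol is HOLOMORPHIC on the open disc
`‖z‖ < R`. [folklore] -/
theorem differentiableOn_dirSymbolC (hE : ExpMoment f v R) :
    DifferentiableOn ℂ (dirSymbolC f v) (Metric.ball (0 : ℂ) R) := by
  have h := Complex.differentiableOn_tsum_of_summable_norm (U := Metric.ball (0 : ℂ) R)
    (F := fun x (z : ℂ) => (f x : ℂ) * Complex.cos (z * (ipair v x : ℂ)))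
    (u := fun x => |f x| * Real.exp (R * |ipair v x|)) hE
    (fun x => (differentiable_term f v x).differentiableOn) Metric.isOpen_ball
    (fun x w hw => norm_term_le (le_of_lt (by simpa using hw)) x)
  exact h

/-- … and CONTINUOUS on the closed disc `‖z‖ ≤ R`. [folklore] -/
theorem continuousOn_dirSymbolC (hE : ExpMoment f v R) :
    ContinuousOn (dirSymbolC f v) (Metric.closedBall (0 : ℂ) R) := by
  have h := continuousOn_tsum (s := Metric.closedBall (0 : ℂ) R)
    (f := fun x (z : ℂ) => (f x : ℂ) * Complex.cos (z * (ipair v x : ℂ)))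
    (u := fun x => |f x| * Real.exp (R * |ipair v x|))
    (fun x => (differentiable_term f v x).continuous.continuousOn) hE
    (fun x w hw => norm_term_le (by simpa using hw) x)
  exact h

/-- Hence `DiffContOnCl` on the disc — the hypothesis of Cauchy's estimate. [folklore] -/
theorem diffContOnCl_dirSymbolC (hE : ExpMoment f v R) :
    DiffContOnCl ℂ (dirSymbolC f v) (Metric.ball (0 : ℂ) R) :=
  DiffContOnCl.mk_ball (differentiableOn_dirSymbolC hE) (continuousOn_dirSymbolC hE)

/-- On the real axis the complexified symbol IS the directional symbol. [folklore] -/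
theorem dirSymbolC_ofReal (f : (Fin d → ℤ) → ℝ) (v : Fin d → ℤ) (t : ℝ) :
    dirSymbolC f v (t : ℂ) = (dirSymbol f v t : ℂ) := by
  unfold dirSymbolC dirSymbol
  rw [Complex.ofReal_tsum]
  refine tsum_congr fun x => ?_
  push_cast
  rfl

variable (hf : Summable fun x => |f x| * size x ^ 2)
include hf

/-- At real points of the disc the complex derivative is the real one: `(dirSymbolC f v)′(t) = dirSymbolD1 f v t`.
[folklore] -/
theorem deriv_dirSymbolC_ofReal (hE : ExpMoment f v R) {t : ℝ} (ht : |t| < R) :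
    deriv (dirSymbolC f v) (t : ℂ) = (dirSymbolD1 f v t : ℂ) := by
  have hmem : (t : ℂ) ∈ Metric.ball (0 : ℂ) R := by simpa using ht
  have h1 : HasDerivAt (dirSymbolC f v) (deriv (dirSymbolC f v) (t : ℂ)) (t : ℂ) :=
    ((differentiableOn_dirSymbolC hE).differentiableAt (Metric.isOpen_ball.mem_nhds hmem)).hasDerivAt
  have h2 : HasDerivAt (fun s : ℝ => dirSymbolC f v (s : ℂ)) (deriv (dirSymbolC f v) (t : ℂ)) t :=
    h1.comp_ofReal
  have h3 : HasDerivAt (fun s : ℝ => (dirSymbol f v s : ℂ)) ((dirSymbolD1 f v t : ℂ)) t :=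
    (hasDerivAt_dirSymbol hf v t).ofReal_comp
  have he : (fun s : ℝ => dirSymbolC f v (s : ℂ)) = fun s : ℝ => (dirSymbol f v s : ℂ) :=
    funext fun s => dirSymbolC_ofReal f v s
  rw [he] at h2
  exact h2.unique h3

/-- … and the complex SECOND derivative at `0` is the real curvature `dirSymbolD2 f v 0 = −Σ' x, f x ⟨v,x⟩²`.
[folklore] -/
theorem iteratedDeriv_two_dirSymbolC_zero (hE : ExpMoment f v R) (hR : 0 < R) :
    iteratedDeriv 2 (dirSymbolC f v) 0 = (dirSymbolD2 f v 0 : ℂ) := by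
  rw [iteratedDeriv_succ, iteratedDeriv_one]
  set g := dirSymbolC f v with hg
  have hd : DifferentiableOn ℂ (deriv g) (Metric.ball (0 : ℂ) R) :=
    (differentiableOn_dirSymbolC hE).deriv Metric.isOpen_ball
  have hmem : (0 : ℂ) ∈ Metric.ball (0 : ℂ) R := by simpa using hR
  have h1 : HasDerivAt (deriv g) (deriv (deriv g) 0) 0 :=
    (hd.differentiableAt (Metric.isOpen_ball.mem_nhds hmem)).hasDerivAt
  have h1' : HasDerivAt (deriv g) (deriv (deriv g) ((0 : ℝ) : ℂ)) ((0 : ℝ) : ℂ) := by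
    simpa using h1
  have h2 : HasDerivAt (fun s : ℝ => deriv g (s : ℂ)) (deriv (deriv g) ((0 : ℝ) : ℂ)) 0 :=
    h1'.comp_ofReal
  -- near `0` on the real axis, `deriv g ∘ ofReal = ofReal ∘ dirSymbolD1 f v`
  have hev : (fun s : ℝ => deriv g (s : ℂ)) =ᶠ[𝓝 (0 : ℝ)] fun s : ℝ => (dirSymbolD1 f v s : ℂ) := by
    have hI : Set.Ioo (-R) R ∈ 𝓝 (0 : ℝ) := Ioo_mem_nhds (by linarith) hR
    filter_upwards [hI] with s hs
    exact deriv_dirSymbolC_ofReal hf hE (abs_lt.mpr ⟨hs.1, hs.2⟩)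
  have h3 : HasDerivAt (fun s : ℝ => (dirSymbolD1 f v s : ℂ)) ((dirSymbolD2 f v 0 : ℂ)) 0 :=
    (hasDerivAt_dirSymbolD1 hf v 0).ofReal_comp
  have h2' : HasDerivAt (fun s : ℝ => (dirSymbolD1 f v s : ℂ)) (deriv (deriv g) ((0 : ℝ) : ℂ)) 0 :=
    h2.congr_of_eventuallyEq hev.symm
  have := h2'.unique h3
  simpa using this

/-- **CAUCHY'S ESTIMATE FOR THE ZERO-MOMENTUM CURVATURE.**  If `f` has a summable second moment and an exponential
moment of radius `R > 0` along `v`, and its complexified directional symbol is bounded by `ε` on the circle `‖z‖ = R`,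
then `|dirSymbolD2 f v 0| ≤ 2ε/R²` — with NO position-space decay constant. [folklore] -/
theorem abs_dirSymbolD2_zero_le_of_sphere (hE : ExpMoment f v R) (hR : 0 < R) {ε : ℝ}
    (hε : ∀ z ∈ Metric.sphere (0 : ℂ) R, ‖dirSymbolC f v z‖ ≤ ε) :
    |dirSymbolD2 f v 0| ≤ 2 * ε / R ^ 2 := by
  have h := Complex.norm_iteratedDeriv_le_of_forall_mem_sphere_norm_le 2 hR (diffContOnCl_dirSymbolC hE) hε
  rw [iteratedDeriv_two_dirSymbolC_zero hf hE hR, Complex.norm_real, Real.norm_eq_abs] at h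
  simpa [Nat.factorial] using h

end Strip

/-! ### 5.2 Linearity bookkeeping and the exponential moment from (5.10) -/

/-- The zero-momentum curvature is linear in the kernel: difference form. [folklore] -/
theorem dirSymbolD2_zero_sub {f g : (Fin d → ℤ) → ℝ} (hf : Summable fun x => |f x| * size x ^ 2)
    (hg : Summable fun x => |g x| * size x ^ 2) (v : Fin d → ℤ) :
    dirSymbolD2 (fun x => f x - g x) v 0 = dirSymbolD2 f v 0 - dirSymbolD2 g v 0 := by
  rw [dirSymbolD2_zero, dirSymbolD2_zero, dirSymbolD2_zero]
  have h1 : Summable fun x => f x * ipair v x ^ 2 :=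
    (summable_abs_mul_ipair_sq hf v).of_norm_bounded (fun x => by
      rw [Real.norm_eq_abs, abs_mul, abs_sq])
  have h2 : Summable fun x => g x * ipair v x ^ 2 :=
    (summable_abs_mul_ipair_sq hg v).of_norm_bounded (fun x => by
      rw [Real.norm_eq_abs, abs_mul, abs_sq])
  rw [← neg_sub, ← neg_add', neg_inj]
  rw [show (fun x => (f x - g x) * ipair v x ^ 2) = fun x => f x * ipair v x ^ 2 - g x * ipair v x ^ 2 from
    funext fun x => by ring]
  rw [h1.tsum_sub h2]
  ring

/-- The complexified symbol is linear in the kernel: difference form, on the closed disc. [folklore] -/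
theorem dirSymbolC_sub {f g : (Fin d → ℤ) → ℝ} {v : Fin d → ℤ} {R : ℝ} (hf : ExpMoment f v R)
    (hg : ExpMoment g v R) {z : ℂ} (hz : ‖z‖ ≤ R) :
    dirSymbolC (fun x => f x - g x) v z = dirSymbolC f v z - dirSymbolC g v z := by
  unfold dirSymbolC
  have h1 : Summable fun x => (f x : ℂ) * Complex.cos (z * (ipair v x : ℂ)) :=
    Summable.of_norm_bounded hf (fun x => norm_term_le hz x)
  have h2 : Summable fun x => (g x : ℂ) * Complex.cos (z * (ipair v x : ℂ)) :=
    Summable.of_norm_bounded hg (fun x => norm_term_le hz x)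
  rw [← h1.tsum_sub h2]
  refine tsum_congr fun x => ?_
  push_cast
  ring

/-- A summable second moment of a difference. [folklore] -/
theorem summable_moment_sub {f g : (Fin d → ℤ) → ℝ} (hf : Summable fun x => |f x| * size x ^ 2)
    (hg : Summable fun x => |g x| * size x ^ 2) : Summable fun x => |f x - g x| * size x ^ 2 := by
  refine Summable.of_nonneg_of_le (fun x => mul_nonneg (abs_nonneg _) (sq_nonneg _)) (fun x => ?_) (hf.add hg)
  have he := sq_nonneg (size x)
  calc |f x - g x| * size x ^ 2
      ≤ (|f x| + |g x|) * size x ^ 2 := mul_le_mul_of_nonneg_right (abs_sub _ _) he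
    _ = |f x| * size x ^ 2 + |g x| * size x ^ 2 := add_mul _ _ _

/-- An exponential moment of a difference. [folklore] -/
theorem ExpMoment.sub {f g : (Fin d → ℤ) → ℝ} {v : Fin d → ℤ} {R : ℝ} (hf : ExpMoment f v R)
    (hg : ExpMoment g v R) : ExpMoment (fun x => f x - g x) v R := by
  refine Summable.of_nonneg_of_le (fun x => mul_nonneg (abs_nonneg _) (Real.exp_nonneg _))
    (fun x => ?_) (hf.add hg)
  have he := Real.exp_nonneg (R * |ipair v x|)
  calc |f x - g x| * Real.exp (R * |ipair v x|)
      ≤ (|f x| + |g x|) * Real.exp (R * |ipair v x|) := mul_le_mul_of_nonneg_right (abs_sub _ _) he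
    _ = |f x| * Real.exp (R * |ipair v x|) + |g x| * Real.exp (R * |ipair v x|) := add_mul _ _ _

/-- `|⟨v,x⟩| ≤ K·|x|₁` when every `|v_i| ≤ K`. [folklore] -/
theorem abs_ipair_le_l1 {v : Fin d → ℤ} {K : ℝ} (hv : ∀ i, |(v i : ℝ)| ≤ K) (x : Fin d → ℤ) :
    |ipair v x| ≤ K * B12Sec2to5.l1 x := by
  unfold ipair B12Sec2to5.l1
  rw [Finset.mul_sum]
  refine (Finset.abs_sum_le_sum_abs _ _).trans (Finset.sum_le_sum fun i _ => ?_)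
  rw [abs_mul]
  exact mul_le_mul_of_nonneg_right (hv i) (abs_nonneg _)

/-- **The exponential moment from the printed decay (5.10)**: `|f x| ≤ C e^{−δ₁|x|₁}` and `|v_i| ≤ K`, `R·K < δ₁`
give `ExpMoment f v R` (for the three directions `e_μ, e_ν, e_μ + e_ν`, `μ ≠ ν`, of `secondMoment_eq_polarization`
one has `K = 1`, so every radius `R < δ₁` is admissible). [cite: Balaban1987RG1, (5.10) p.293] -/
theorem expMoment_of_decay510 {f : (Fin d → ℤ) → ℝ} {C δ₁ : ℝ} (hdec : B12Sec2to5.Decay510 f C δ₁)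
    {v : Fin d → ℤ} {K R : ℝ} (hv : ∀ i, |(v i : ℝ)| ≤ K) (hR : 0 ≤ R) (hRK : R * K < δ₁) :
    ExpMoment f v R := by
  have hC : 0 ≤ C := by
    have h := hdec 0
    have he : 0 < Real.exp (-δ₁ * B12Sec2to5.l1 (0 : Fin d → ℤ)) := Real.exp_pos _
    exact (mul_nonneg_iff_of_pos_right he).mp ((abs_nonneg _).trans h)
  have hpos : 0 < δ₁ - R * K := by linarith
  refine Summable.of_nonneg_of_le (fun x => mul_nonneg (abs_nonneg _) (Real.exp_nonneg _))
    (fun x => ?_) ((B12Sec2to5.summable_exp_neg_l1 hpos d).mul_left C)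
  have h1 := hdec x
  have h2 : R * |ipair v x| ≤ R * K * B12Sec2to5.l1 x := by
    have := abs_ipair_le_l1 hv x
    nlinarith
  calc |f x| * Real.exp (R * |ipair v x|)
      ≤ C * Real.exp (-δ₁ * B12Sec2to5.l1 x) * Real.exp (R * K * B12Sec2to5.l1 x) :=
        mul_le_mul h1 (Real.exp_le_exp.mpr h2) (Real.exp_nonneg _)
          (mul_nonneg hC (Real.exp_nonneg _))
    _ = C * Real.exp (-(δ₁ - R * K) * B12Sec2to5.l1 x) := by
        rw [mul_assoc, ← Real.exp_add]; ring_nf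

end

/-! ## 6. (v1.2) THE THREE-LINES UPGRADE — REAL-zone rates + the printed UNIFORM decay already give the circle
rates of §5: if the step difference of two complexified directional symbols is `≤ ε` on the REAL axis and `≤ M` on the
closed strip `|Im z| ≤ R` (the latter is free from a k-uniform exponential moment, i.e. from (5.10)), then Hadamard's
three-lines theorem (Mathlib `Complex.HadamardThreeLines.norm_le_interp_of_mem_verticalClosedStrip₀₁'`) gives
`‖D z‖ ≤ ε^{1−|Im z|/R} · M^{|Im z|/R}` on the strip, hence `≤ ε^{1−r/R} M^{r/R}` on the circle `‖z‖ = r < R`; with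
`ε = cθ^k` this is a geometric rate with ratio `θ^{1−r/R}` (`RateCertificate` §9).  So suppliers may prove rates on the
REAL Brillouin zone only (King 1986 Prop. 3.10 / Lemma 4.4 shape); no complexification of their estimates is needed.
[folklore] complex analysis about ARBITRARY `f`, `g`; nothing about Bałaban's kernels. -/

section ThreeLines

open Complex.HadamardThreeLines (verticalStrip verticalClosedStrip)

variable {d : ℕ} {f g : (Fin d → ℤ) → ℝ} {v : Fin d → ℤ} {R : ℝ}

/-- Term bound on the closed STRIP `|Im z| ≤ R`: `‖f x · cos (z⟨v,x⟩)‖ ≤ |f x| e^{R|⟨v,x⟩|}`. [folklore] -/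
theorem norm_term_le_of_im {z : ℂ} (hz : |z.im| ≤ R) (x : Fin d → ℤ) :
    ‖(f x : ℂ) * Complex.cos (z * (ipair v x : ℂ))‖ ≤ |f x| * Real.exp (R * |ipair v x|) := by
  rw [norm_mul, Complex.norm_real, Real.norm_eq_abs]
  refine mul_le_mul_of_nonneg_left ?_ (abs_nonneg _)
  refine (Literature.Probability.LatticeModels.BesselInterp.norm_cos_le_exp_abs_im _).trans
    (Real.exp_le_exp.mpr ?_)
  rw [Complex.im_mul_ofReal, abs_mul]
  exact mul_le_mul_of_nonneg_right hz (abs_nonneg _)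

/-- Under an exponential moment of radius `R` the complexified symbol is HOLOMORPHIC on the open strip
`|Im z| < R`. [folklore] -/
theorem differentiableOn_dirSymbolC_strip (hE : ExpMoment f v R) :
    DifferentiableOn ℂ (dirSymbolC f v) (Complex.im ⁻¹' Set.Ioo (-R) R) := by
  have h := Complex.differentiableOn_tsum_of_summable_norm (U := Complex.im ⁻¹' Set.Ioo (-R) R)
    (F := fun x (z : ℂ) => (f x : ℂ) * Complex.cos (z * (ipair v x : ℂ)))
    (u := fun x => |f x| * Real.exp (R * |ipair v x|)) hE
    (fun x => (differentiable_term f v x).differentiableOn) (isOpen_Ioo.preimage Complex.continuous_im)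
    (fun x w hw => norm_term_le_of_im (le_of_lt (abs_lt.mpr hw)) x)
  exact h

/-- … and CONTINUOUS on the closed strip `|Im z| ≤ R`. [folklore] -/
theorem continuousOn_dirSymbolC_strip (hE : ExpMoment f v R) :
    ContinuousOn (dirSymbolC f v) (Complex.im ⁻¹' Set.Icc (-R) R) := by
  have h := continuousOn_tsum (s := Complex.im ⁻¹' Set.Icc (-R) R)
    (f := fun x (z : ℂ) => (f x : ℂ) * Complex.cos (z * (ipair v x : ℂ)))
    (u := fun x => |f x| * Real.exp (R * |ipair v x|))
    (fun x => (differentiable_term f v x).continuous.continuousOn) hE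
    (fun x w hw => norm_term_le_of_im (abs_le.mpr hw) x)
  exact h

/-- The UNIFORM STRIP BOUND from the exponential moment: `‖Σ' f x cos (z⟨v,x⟩)‖ ≤ Σ' |f x| e^{R|⟨v,x⟩|}` for
`|Im z| ≤ R`. [folklore] -/
theorem norm_dirSymbolC_le_of_im (hE : ExpMoment f v R) {z : ℂ} (hz : |z.im| ≤ R) :
    ‖dirSymbolC f v z‖ ≤ ∑' x, |f x| * Real.exp (R * |ipair v x|) :=
  tsum_of_norm_bounded hE.hasSum (fun x => norm_term_le_of_im hz x)

/-- **Hadamard three lines between the real axis and the edge of a horizontal strip.** For `F` holomorphic on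
`|Im z| < R`, continuous on `|Im z| ≤ R`, bounded by `ε` on the real axis and by `M` on the closed strip:
`‖F z‖ ≤ ε^{1−|Im z|/R} · M^{|Im z|/R}`. [folklore] (Mathlib's vertical-strip theorem transported by `w ↦ ±iR·w`.) -/
theorem norm_le_interp_of_real_of_strip {F : ℂ → ℂ} {R ε M : ℝ} (hR : 0 < R)
    (hd : DifferentiableOn ℂ F (Complex.im ⁻¹' Set.Ioo (-R) R))
    (hc : ContinuousOn F (Complex.im ⁻¹' Set.Icc (-R) R))
    (hε : ∀ t : ℝ, ‖F t‖ ≤ ε) (hM : ∀ z : ℂ, |z.im| ≤ R → ‖F z‖ ≤ M)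
    {z : ℂ} (hz : |z.im| ≤ R) :
    ‖F z‖ ≤ ε ^ (1 - |z.im| / R) * M ^ (|z.im| / R) := by
  -- the sign of `Im z` decides which half-strip we transport
  set s : ℝ := if 0 ≤ z.im then R else -R with hs
  have hsabs : |s| = R := by
    rw [hs]; split_ifs <;> simp [abs_of_pos hR]
  have hs0 : s ≠ 0 := by
    intro h; rw [h, abs_zero] at hsabs; exact hR.ne' hsabs.symm
  have hzs : z.im / s = |z.im| / R := by
    rw [hs]; split_ifs with h
    · rw [abs_of_nonneg h]
    · rw [abs_of_neg (lt_of_not_ge h), div_neg, neg_div]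
  -- the transport `w ↦ u * w`, `u = i s`
  set u : ℂ := Complex.I * (s : ℂ) with hu
  have hu0 : u ≠ 0 := mul_ne_zero Complex.I_ne_zero (Complex.ofReal_ne_zero.mpr hs0)
  have him : ∀ w : ℂ, (u * w).im = s * w.re := by
    intro w; simp [hu, Complex.mul_im, Complex.mul_re]
  have hre : ∀ w : ℂ, (u * w).re = -(s * w.im) := by
    intro w; simp [hu, Complex.mul_re, Complex.mul_im]
  set G : ℂ → ℂ := fun w => F (u * w) with hG
  -- DiffContOnCl on the vertical strip `0 < re w < 1`
  have hmaps_open : ∀ w ∈ verticalStrip 0 1, u * w ∈ Complex.im ⁻¹' Set.Ioo (-R) R := by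
    intro w hw
    have hw' : 0 < w.re ∧ w.re < 1 := hw
    show (u * w).im ∈ Set.Ioo (-R) R
    rw [him]
    have h1 : |s * w.re| < R := by
      rw [abs_mul, hsabs, abs_of_pos hw'.1]
      calc R * w.re < R * 1 := mul_lt_mul_of_pos_left hw'.2 hR
        _ = R := mul_one R
    exact abs_lt.mp h1
  have hmaps_closed : ∀ w ∈ verticalClosedStrip 0 1, |(u * w).im| ≤ R := by
    intro w hw
    have hw' : 0 ≤ w.re ∧ w.re ≤ 1 := hw
    rw [him, abs_mul, hsabs, abs_of_nonneg hw'.1]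
    calc R * w.re ≤ R * 1 := mul_le_mul_of_nonneg_left hw'.2 hR.le
      _ = R := mul_one R
  have hclosure : closure (verticalStrip 0 1) = verticalClosedStrip 0 1 := by
    rw [verticalStrip, verticalClosedStrip, Complex.closure_preimage_re, closure_Ioo zero_ne_one]
  have hdiff : DifferentiableOn ℂ G (verticalStrip 0 1) := by
    intro w hw
    have hopen : IsOpen (Complex.im ⁻¹' Set.Ioo (-R) R) := isOpen_Ioo.preimage Complex.continuous_im
    have hFat : DifferentiableAt ℂ F (u * w) := hd.differentiableAt (hopen.mem_nhds (hmaps_open w hw))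
    exact (hFat.comp w ((differentiableAt_const u).mul differentiableAt_id)).differentiableWithinAt
  have hcont : ContinuousOn G (closure (verticalStrip 0 1)) := by
    rw [hclosure]
    refine hc.comp ((continuous_const.mul continuous_id).continuousOn) ?_
    intro w hw
    exact abs_le.mp (hmaps_closed w hw)
  have hdc : DiffContOnCl ℂ G (verticalStrip 0 1) := ⟨hdiff, hcont⟩
  have hB : BddAbove ((norm ∘ G) '' verticalClosedStrip 0 1) := by
    refine ⟨M, ?_⟩
    rintro _ ⟨w, hw, rfl⟩
    exact hM _ (hmaps_closed w hw)
  have ha : ∀ w ∈ Complex.re ⁻¹' ({0} : Set ℝ), ‖G w‖ ≤ ε := by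
    intro w hw
    have hw0 : w.re = 0 := hw
    have hreal : u * w = ((-(s * w.im) : ℝ) : ℂ) := by
      apply Complex.ext
      · rw [hre, Complex.ofReal_re]
      · rw [him, hw0, mul_zero, Complex.ofReal_im]
    show ‖F (u * w)‖ ≤ ε
    rw [hreal]; exact hε _
  have hb : ∀ w ∈ Complex.re ⁻¹' ({1} : Set ℝ), ‖G w‖ ≤ M := by
    intro w hw
    have hw1 : w.re = 1 := hw
    refine hM _ ?_
    rw [him, hw1, mul_one, hsabs]
  -- the point `w₀ = z / u`
  set w₀ : ℂ := z / u with hw₀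
  have huw₀ : u * w₀ = z := by rw [hw₀]; field_simp
  have hw₀re : w₀.re = |z.im| / R := by
    have h1 : (u * w₀).im = s * w₀.re := him w₀
    rw [huw₀] at h1
    rw [← hzs, h1]; field_simp
  have hw₀mem : w₀ ∈ verticalClosedStrip 0 1 := by
    refine ⟨?_, ?_⟩
    · rw [hw₀re]; positivity
    · rw [hw₀re]; exact (div_le_one hR).mpr hz
  have key := Complex.HadamardThreeLines.norm_le_interp_of_mem_verticalClosedStrip₀₁' G hw₀mem hdc hB
    ha hb
  have hGz : G w₀ = F z := by simp only [hG, huw₀]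
  rw [hGz, hw₀re] at key
  exact key

/-- **On the circle.** With `0 < ε ≤ M` the strip interpolation bound is monotone in `|Im z| ≤ ‖z‖ = r`, so on the
circle `‖z‖ = r ≤ R`: `‖F z‖ ≤ ε^{1−r/R} M^{r/R}`. [folklore] -/
theorem norm_le_interp_of_sphere {F : ℂ → ℂ} {R r ε M : ℝ} (hR : 0 < R) (hrR : r ≤ R)
    (hd : DifferentiableOn ℂ F (Complex.im ⁻¹' Set.Ioo (-R) R))
    (hc : ContinuousOn F (Complex.im ⁻¹' Set.Icc (-R) R))
    (hε0 : 0 < ε) (hεM : ε ≤ M)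
    (hε : ∀ t : ℝ, ‖F t‖ ≤ ε) (hM : ∀ z : ℂ, |z.im| ≤ R → ‖F z‖ ≤ M)
    {z : ℂ} (hz : z ∈ Metric.sphere (0 : ℂ) r) :
    ‖F z‖ ≤ ε ^ (1 - r / R) * M ^ (r / R) := by
  have hzr : ‖z‖ = r := by simpa using hz
  have him : |z.im| ≤ r := hzr ▸ Complex.abs_im_le_norm z
  have himR : |z.im| ≤ R := him.trans hrR
  have h1 := norm_le_interp_of_real_of_strip hR hd hc hε hM himR
  refine h1.trans ?_
  -- monotonicity of `y ↦ ε^{1-y} M^{y} = ε · (M/ε)^y`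
  have hM0 : 0 < M := hε0.trans_le hεM
  have hy : |z.im| / R ≤ r / R := div_le_div_of_nonneg_right him hR.le
  have hratio : 1 ≤ M / ε := (one_le_div hε0).mpr hεM
  have e1 : ∀ y : ℝ, ε ^ (1 - y) * M ^ y = ε * (M / ε) ^ y := by
    intro y
    rw [Real.rpow_sub hε0, Real.rpow_one, Real.div_rpow hM0.le hε0.le]
    field_simp
  rw [e1, e1]
  exact mul_le_mul_of_nonneg_left (Real.rpow_le_rpow_of_exponent_le hratio hy) hε0.le

/-- **The step difference of two complexified symbols, three lines.** `f`, `g` with exponential moments of radius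
`R`; their symbol difference `≤ ε` on the real axis (a REAL-zone rate) and `0 < ε ≤ M` where `M` bounds the
difference on the strip: on the circle `‖z‖ = r ≤ R` the difference is `≤ ε^{1−r/R} M^{r/R}`. [folklore] -/
theorem norm_dirSymbolC_sub_le_of_real {R r ε M : ℝ} (hf : ExpMoment f v R) (hg : ExpMoment g v R)
    (hR : 0 < R) (hrR : r ≤ R) (hε0 : 0 < ε) (hεM : ε ≤ M)
    (hε : ∀ t : ℝ, |dirSymbol f v t - dirSymbol g v t| ≤ ε)
    (hM : ∀ z : ℂ, |z.im| ≤ R → ‖dirSymbolC f v z - dirSymbolC g v z‖ ≤ M)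
    {z : ℂ} (hz : z ∈ Metric.sphere (0 : ℂ) r) :
    ‖dirSymbolC f v z - dirSymbolC g v z‖ ≤ ε ^ (1 - r / R) * M ^ (r / R) := by
  refine norm_le_interp_of_sphere (F := fun z => dirSymbolC f v z - dirSymbolC g v z) hR hrR
    ((differentiableOn_dirSymbolC_strip hf).sub (differentiableOn_dirSymbolC_strip hg))
    ((continuousOn_dirSymbolC_strip hf).sub (continuousOn_dirSymbolC_strip hg)) hε0 hεM ?_ hM hz
  intro t
  show ‖dirSymbolC f v (t : ℂ) - dirSymbolC g v (t : ℂ)‖ ≤ ε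
  rw [dirSymbolC_ofReal, dirSymbolC_ofReal, ← Complex.ofReal_sub, Complex.norm_real, Real.norm_eq_abs]
  exact hε t

/-- The strip bound of a difference from the two exponential-moment sums. [folklore] -/
theorem norm_dirSymbolC_sub_le_of_im (hf : ExpMoment f v R) (hg : ExpMoment g v R) {z : ℂ}
    (hz : |z.im| ≤ R) :
    ‖dirSymbolC f v z - dirSymbolC g v z‖
      ≤ (∑' x, |f x| * Real.exp (R * |ipair v x|)) + ∑' x, |g x| * Real.exp (R * |ipair v x|) :=
  (norm_sub_le _ _).trans (add_le_add (norm_dirSymbolC_le_of_im hf hz) (norm_dirSymbolC_le_of_im hg hz))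

/-- Rate algebra for the exponent loss: `(c·θ^k)^α = c^α · (θ^α)^k` (`0 ≤ c`, `0 ≤ θ`). [folklore] -/
theorem rpow_rate (c θ α : ℝ) (hc : 0 ≤ c) (hθ : 0 ≤ θ) (k : ℕ) :
    (c * θ ^ k) ^ α = c ^ α * (θ ^ α) ^ k := by
  rw [Real.mul_rpow hc (pow_nonneg hθ k), ← Real.rpow_natCast θ k, ← Real.rpow_mul hθ,
    mul_comm (k : ℝ) α, Real.rpow_mul hθ, Real.rpow_natCast]

/-- **The uniform strip bound from the printed decay (5.10)**, with the explicit constant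
`C · Σ_x e^{−(δ₁ − R·K)|x|₁}`: `|f x| ≤ C e^{−δ₁|x|₁}`, `|v_i| ≤ K`, `R·K < δ₁`, `|Im z| ≤ R` ⟹
`‖Σ' f x cos (z⟨v,x⟩)‖ ≤ C · Σ' e^{−(δ₁−RK)|x|₁}`. [cite: Balaban1987RG1, (5.10) p.293] -/
theorem norm_dirSymbolC_le_of_decay510 {C δ₁ : ℝ} (hdec : B12Sec2to5.Decay510 f C δ₁)
    {K : ℝ} (hv : ∀ i, |(v i : ℝ)| ≤ K) (hR : 0 ≤ R) (hRK : R * K < δ₁) {z : ℂ} (hz : |z.im| ≤ R) :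
    ‖dirSymbolC f v z‖ ≤ C * ∑' x : Fin d → ℤ, Real.exp (-(δ₁ - R * K) * B12Sec2to5.l1 x) := by
  have hC : 0 ≤ C := by
    have h := hdec 0
    have he : 0 < Real.exp (-δ₁ * B12Sec2to5.l1 (0 : Fin d → ℤ)) := Real.exp_pos _
    exact (mul_nonneg_iff_of_pos_right he).mp ((abs_nonneg _).trans h)
  have hpos : 0 < δ₁ - R * K := by linarith
  have hsum := B12Sec2to5.summable_exp_neg_l1 hpos d
  have hE : ExpMoment f v R := expMoment_of_decay510 hdec hv hR hRK
  refine (norm_dirSymbolC_le_of_im hE hz).trans ?_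
  rw [← tsum_mul_left]
  refine Summable.tsum_le_tsum (fun x => ?_) hE (hsum.mul_left C)
  have h1 := hdec x
  have h2 : R * |ipair v x| ≤ R * K * B12Sec2to5.l1 x := by
    have := abs_ipair_le_l1 hv x
    nlinarith
  calc |f x| * Real.exp (R * |ipair v x|)
      ≤ C * Real.exp (-δ₁ * B12Sec2to5.l1 x) * Real.exp (R * K * B12Sec2to5.l1 x) :=
        mul_le_mul h1 (Real.exp_le_exp.mpr h2) (Real.exp_nonneg _)
          (mul_nonneg hC (Real.exp_nonneg _))
    _ = C * Real.exp (-(δ₁ - R * K) * B12Sec2to5.l1 x) := by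
        rw [mul_assoc, ← Real.exp_add]; ring_nf

/-- Exponential moments are monotone in the radius. [folklore] -/
theorem ExpMoment.mono {r : ℝ} (h : ExpMoment f v R) (hrR : r ≤ R) : ExpMoment f v r :=
  Summable.of_nonneg_of_le (fun _ => mul_nonneg (abs_nonneg _) (Real.exp_nonneg _))
    (fun _ => mul_le_mul_of_nonneg_left
      (Real.exp_le_exp.mpr (mul_le_mul_of_nonneg_right hrR (abs_nonneg _))) (abs_nonneg _)) h

end ThreeLines

end Literature.MathematicalPhysics.QuantumFieldTheory.Balaban1983to89.Beta.MomentSymbol
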